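import Mathlib
import HarnessLib
import Summits.ValiantsHypothesis.ValiantsHypothesis.Theses.MonotoneRestoration
import Literature.Computability.AlgebraicComplexity.CircuitDepth
import Literature.Computability.AlgebraicComplexity.SymmetricOrbitCircuitEval
import Summits.ValiantsHypothesis.ValiantsHypothesis.Theorems.MonotoneRestorationMonotoneRestorationQPSparseRegime
import Summits.ValiantsHypothesis.ValiantsHypothesis.Theorems.MonotoneRestorationOrbitRestorationQPCircuitOfEquivariantTerms
import Summits.ValiantsHypothesis.ValiantsHypothesis.Theorems.MonotoneRestorationOrbitRestorationQPVsbr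
import Summits.ValiantsHypothesis.ValiantsHypothesis.Theorems.MonotoneRestorationOrbitRestorationQPSigmaPiSigmaK
import Literature.Computability.AlgebraicComplexity.DepthThreeRankBound

/-!
# Skeleton — crux `OrbitRestorationQP`, line `depth-three-rung` (fwd-ladder G4, ladder-down)

Crux item `stmt-ValiantsHypothesis-18293`
(`Summit.ValiantsHypothesis.ValiantsHypothesis.Theses.MonotoneRestoration.OrbitRestorationQP` = `X`, the
SOLE binder of the route's `closes`; `X → ValiantsHypothesis` is landed as the route's deciding theorem,
the converse is NOT known — a strengthening top on the Frontier shelf).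

THE LADDER (in `X`'s own language).  `X` quantifies over ALL matrix-symmetric `VP` families.  Grade the
HYPOTHESIS CLASS: `RestorationOn 𝒞` := "every matrix-symmetric family whose members lie in the class
`𝒞 n c` (one constant `c`) has square-symmetric circuits of quasi-polynomial ORBIT size".  It is
antitone in `𝒞` (`restorationOn_antitone`) and `X ↔ RestorationOn VPClass` (`orbitRestorationQP_iff`).
Along the PRODUCT-DEPTH filtration of `VP` (Limaye–Srinivasan–Tavenas' `Δ`, tree
`ArithCircuit.productDepth`; `PDClass δ` = polynomial degree, complexity and a product-depth-`≤ δ n`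
circuit with polynomially many wires):

* FLOOR (proved, `Lines/DepthThreeRung_special.lean`, theorem `sparseRestorationQP`):
  `RestorationOn SparseClass` — polynomially many monomials: the orbit circuit of the tree
  (`OrbitCircuit.exists_symmetric_circuit_of_invariant`); the monomial expansion is CANONICAL, hence
  equivariant.  (Also proved in the tree, same mechanism: polylog degree, qp-sparse — route file §γ.)
* RUNG 1 = THIS LINE'S TARGET: `SigmaPiSigmaRestorationQP := RestorationOn (PDClass 1)` — families with
  polynomial-size `ΣΠΣ` (product-depth-1) circuits.  First class whose small representations are NOT
  canonical (no unique depth-3 normal form), so equivariance must be CREATED.  `VH`-free: by LST21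
  (tree `Literature/…/LST21*.lean`, `Barriers/…/DepthThreeChasmTight.lean`) no `VNP`-complete family has
  polynomial `ΣΠΣ` circuits over `ℂ`, so the route's deciding argument (`per ∈ VP` ⇒ restore ⇒
  Dawar–Wilsenach Thm 7.1) has nothing to bite on; `SigmaPiSigmaRestorationQP → X` and `→ VH` do not
  close (probes in the fwd-ladder folder `bc/`).
* RUNGS Δ = 2, 3, … (`ProductDepthRestorationQP (fun _ => Δ)`), still `VH`-free by LST21 for every
  constant `Δ`;
* LIMIT `LogDepthRestorationQP := ∀ c₀, ProductDepthRestorationQP (fun n => c₀ * (log₂ n + 1))` — this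
  IS `X` modulo Valiant–Skyum–Berkowitz–Rackoff (`stub_vsbr`: `VP` = polynomial size in product-depth
  `O(log n)`): `OrbitRestorationQP_of_ladder` / `restorationOnVP_of_ladder` below and `logDepthRestorationQP_of_orbitRestorationQP`.  It is
  registered only to make the ladder's top kernel-visible; it is NOT a prover target (summit-strength of
  the crux: `X`-equivalent given VSBR).

THE RUNG'S OWN CUT (`SigmaPiSigmaRestorationQP_of`, proved): `stub_equivariantTerms` (load-bearing,
conjecture-grade: a matrix-symmetric `ΣΠΣ`-easy family has an `Sym_n`-STABLE multiset of quasi-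
polynomially many product terms of affine forms summing to it — an equivariant depth-3 normal form of qp
size; mechanism: rigidity of near-minimal depth-3 representations ⇒ the term set is permuted ⇒ orbits ≤
number of terms; sub-ladder by top fan-in: `k = 1` unique factorisation, `k = O(1)` rank bounds for
`ΣΠΣ(k)` identities (Dvir–Shpilka, Kayal–Saraf, Saxena–Seshadhri), `k = poly` open) and
`stub_circuitOfEquivariantTerms` (provable now, size L: an `Sym_n`-stable term multiset of qp size is
computed by a square-symmetric `LabelledArithCircuit` of qp SIZE, hence qp orbit — the orbit-circuit
construction with affine-form gates).

On-path / honesty lemmas (all proved, no sorry): `onPath` (`X → ProductDepthRestorationQP δ` for every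
`δ`, in particular `X →` the rung), `orbitRestorationQP_iff` (`X ↔ RestorationOn VPClass`),
`restorationOn_antitone`, `logDepthRestorationQP_of_orbitRestorationQP`.
Disproof file: none exists for this crux (2026-08-17).  Negatives honoured: the `VP`-type hypothesis is
kept inside every class (cf. `Theorems/MonotoneRestorationQP/Negative/OrbitRestorationFalseWithoutVP.lean`);
no uniform-constant form (cf. `monotoneRestorationQP_uniform_false`): `∃ c` depends on the family.

RE-REGISTERED 2026-08-27 (planner-val-width-lines-3-g0, cell val-width, director-valiant REQUESTS l.20032 (d)) —
mathematics unchanged; bookkeeping so the registered records match reality: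
* STUB B `stub_circuitOfEquivariantTerms` is LANDED (p548827,
  `Summit.ValiantsHypothesis.ValiantsHypothesis.Theorems.OrbitRestorationQPDepthThreeRung.stub_circuitOfEquivariantTerms`,
  over the Theorems-side copy of this line's vocabulary `Theorems/MonotoneRestorationOrbitRestorationQPDepthThreeRungDefs.lean`);
  its `sorry` is replaced by that theorem (the two vocabularies agree by `δ`-unfolding), so it is no longer a stub and the
  rung `SigmaPiSigmaRestorationQP` now rests on STUB A alone (`sigmaPiSigmaRestorationQP_of_stubs`);
* `stub_logDepthRestoration` (the ladder's LIMIT; `X`-equivalent given VSBR — NOT a prover target) is now stated IN FULL at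
  the granularity of the other stubs (`IsMatrixSymmetric` / `PDClass` / `QPOrbitRestorable`, all present in the Theorems-side
  Defs file) instead of the bare abbreviation `LogDepthRestorationQP` (21 chars), so its registered signature is restatable;
  `logDepth_stub_iff` records the identity with the abbreviation.
Registered stub set after this check: `stub_equivariantTerms` (A, load-bearing, conjecture-grade), `stub_logDepthRestoration`
(limit, crux-strength, never staffed), `stub_vsbr` (VSBR 1983 on the slices, size L, provable now).  VP ≠ VNP not moved.

UPDATE 2026-08-27 (prover-val-width-18293-p3-g0, cell val-width) — mathematics unchanged; `stub_vsbr` is LANDED (p581292,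
`Summit.ValiantsHypothesis.ValiantsHypothesis.Theorems.OrbitRestorationQPDepthThreeRung.stub_vsbr`, file
`Theorems/MonotoneRestorationOrbitRestorationQPVsbr.lean`, over the general VSBR product-depth theorem
`Literature/Computability/AlgebraicComplexity/VSBRProductDepth.lean` (p580653): product-depth `≤ ⌈log₂ d⌉`, polynomially
many wires, any commutative semiring); its `sorry` is replaced by that theorem (δ-unfolding of the two vocabularies).
Registered stub set now: `stub_equivariantTerms` (A, the rung's whole content, conjecture-grade) and `stub_logDepthRestoration`
(the ladder's LIMIT = `X` modulo VSBR, crux-strength, never staffed); `OrbitRestorationQP_of_ladder` rests on the limit stub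
ALONE.  VP ≠ VNP not moved.

RE-REGISTERED 2026-08-28 (prover val-width-18293-p4 g0, cell val-width, director-valiant GO 2026-08-27T23:21:28Z) — STUB A RESHAPED
INTO VALUE CURRENCY AND SPLIT BY TOP FAN-IN.  The old stub A (`IsEquivariantTerms`: an EXACTLY `Sym_n`-stable multiset of qp many
depth-3 terms) is SUPERSEDED-MISCURRENCY: it is strictly stronger than what the rung needs (value orbits, `QPOrbitRestorable`) and is
obstructed by sign characters already at top fan-in 1 (witness `V_n = Π_{P<Q}(x_P − x_Q)`, `n` even: restorable in value currency, no
exactly stable single-orbit term multiset; NO refutation claimed) — kept below as the proposition `SupersededStubA` with its composition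
`SigmaPiSigmaRestorationQP_of` / `sigmaPiSigmaRestorationQP_of_superseded` (old A → landed B → rung), never silently dropped.  New stubs
(crux workfile `Lines/depth-three-rung-stubA-bounded-fanin.md`):
* `stub_piSigmaValue` (A₁, the ΠΣ sub-rung, OPEN): a matrix-symmetric family in `PDClass 1` given at every level as ONE scaled product
  of `≤ n^c + c` affine forms is quasi-polynomially orbit-restorable;
* `stub_sigmaPiSigmaKValue k` (A_k, the ΣΠΣ(k) sub-rung, PROVABLE NOW, size L): the Saxena–Seshadhri rank bound — the named Literature
  fact `Literature.Computability.AlgebraicComplexity.depthThree_rankBound` (p586586), taken BY NAME as a hypothesis, not a sorry — and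
  A₁ imply restoration for matrix-symmetric `PDClass 1` families given as sums of `≤ k` scaled products of `≤ n^c + c` affine forms
  (Structure Theorem S of the workfile: Karnin–Shpilka rank-distance clustering; small stable spaces of affine forms are invariant —
  landed `Theorems/…StableForms.lean`);
* `stub_sigmaPiSigmaValue` (A_∞, the rung itself in value currency = `SigmaPiSigmaRestorationQP` unfolded; conjecture-grade residue:
  unbounded top fan-in).
On-path (proved): `piSigmaValue_of_sigmaPiSigmaValue` (A_∞ → A₁), `sigmaPiSigmaK_of_sigmaPiSigmaValue` (A_∞ → conclusion of A_k),
`sigmaPiSigmaK_of_keys` (RB → A₁ → A_k-conclusion, through the stub), `sigmaPiSigmaRestorationQP_of_stubs : SigmaPiSigmaRestorationQP`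
(from A_∞, definitional).  `stub_logDepthRestoration` and the landed `stub_circuitOfEquivariantTerms`, `stub_vsbr` are byte-identical;
`OrbitRestorationQP_of_ladder` still concludes the crux by name and rests on the limit stub alone.  VP ≠ VNP not moved.

UPDATE 2026-08-28 (prover val-width-18293-p3 g3, cell val-width) — mathematics unchanged; STUB A_k `stub_sigmaPiSigmaKValue` is
LANDED (p594347, `Summit.ValiantsHypothesis.ValiantsHypothesis.Theorems.OrbitRestorationQPDepthThreeRung.stub_sigmaPiSigmaKValue`,
file `Theorems/MonotoneRestorationOrbitRestorationQPSigmaPiSigmaK.lean`): Structure Theorem S of the workfile, kernel-checked end to end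
over seventeen helper files `Theorems/MonotoneRestorationOrbitRestorationQP{ClusterMatching, GoodScale (p4), RankDistance, HomogTools,
RankBoundBridge, ProductAction, LinearSubalgebra, LinNL, LevelRep, LevelMatch, LevelAction, LevelStructureA/B/C, SigmaKThresholds,
PiSigmaClass, Restorable}.lean` (rank distance on normalised factor multisets; the rank bound transported to affine minimal vanishing
families by homogenisation in the fraction field; matching of cluster sums; row/column supports; `K[Λ₁] ∩ K[Λ₂] = K[Λ₁ ∩ Λ₂]` and
closedness by the substitution endomorphism of a projection; Lin/NL split; essential spaces; small stable spaces `⊆ span(1, U)`,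
`U = Σ x_pq`, so non-linear parts are `Q(U)`; untwisting by `±1` characters and minimality; explicit thresholds; small levels cost
one constant).  Its `sorry` is replaced by that theorem (δ-unfolding of the two vocabularies).  Registered stub set now:
`stub_piSigmaValue` (A₁, OPEN, p2's lane), `stub_sigmaPiSigmaValue` (A_∞, conjecture-grade residue), `stub_logDepthRestoration`
(limit, never staffed).  VP ≠ VNP not moved.
-/

set_option linter.dupNamespace false

namespace Summit.ValiantsHypothesis.ValiantsHypothesis.Cruxes.OrbitRestorationQP.DepthThreeRung

open Summit.ValiantsHypothesis.ValiantsHypothesis.Theses.MonotoneRestoration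
open Literature.Computability.AlgebraicComplexity

/-! ### The graded family `RestorationOn 𝒞` -/

/-- Matrix symmetry of a family on the `n × n` variable matrix: invariance under INDEPENDENT row and
column permutations (verbatim the hypothesis of `OrbitRestorationQP`). [folklore] -/
def IsMatrixSymmetric (f : (n : ℕ) → MvPolynomial (Fin n × Fin n) ℂ) : Prop :=
  ∀ (n : ℕ) (σ τ : Equiv.Perm (Fin n)),
    MvPolynomial.rename (fun p : Fin n × Fin n => (σ p.1, τ p.2)) (f n) = f n

/-- Quasi-polynomial ORBIT restorability of one polynomial at level `n` with constant `c`: a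
square-symmetric labelled circuit over `ℂ` (diagonal action of `Sym (Fin n)`) computing `p` all of whose
gate orbits have size `≤ 2^((log₂ n + c)^c)` (verbatim the conclusion of `OrbitRestorationQP`).
[cite: DawarWilsenach2025, §3.3 (ORB)] -/
def QPOrbitRestorable (c n : ℕ) (p : MvPolynomial (Fin n × Fin n) ℂ) : Prop :=
  ∃ (G : Type) (_ : Fintype G) (C : LabelledArithCircuit ℂ (Fin n × Fin n) Unit G),
    C.IsSymmetric (Equiv.Perm (Fin n)) ∧ C.eval (C.output ()) = p ∧
      C.orbitSize (Equiv.Perm (Fin n)) ≤ 2 ^ ((Nat.log 2 n + c) ^ c)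

/-- **The graded family.** `RestorationOn 𝒞`: every matrix-symmetric family whose `n`-th member lies in
the class `𝒞 n c` for one constant `c` and all `n` is quasi-polynomially orbit-restorable.  Antitone in
`𝒞`; `OrbitRestorationQP ↔ RestorationOn VPClass`. [folklore] -/
def RestorationOn (𝒞 : (n : ℕ) → ℕ → MvPolynomial (Fin n × Fin n) ℂ → Prop) : Prop :=
  ∀ f : (n : ℕ) → MvPolynomial (Fin n × Fin n) ℂ, IsMatrixSymmetric f →
    (∃ c : ℕ, ∀ n : ℕ, 𝒞 n c (f n)) → ∃ c : ℕ, ∀ n : ℕ, QPOrbitRestorable c n (f n)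

/-- The class `VP` sliced at level `n` with constant `c`: total degree and fan-in-two complexity
`≤ n^c + c` (Bürgisser's p-bounds, tree `IsPBounded`). [cite: Burgisser2000, Def. 2.4] -/
def VPClass (n c : ℕ) (q : MvPolynomial (Fin n × Fin n) ℂ) : Prop :=
  q.totalDegree ≤ n ^ c + c ∧ complexity q ≤ n ^ c + c

/-- The product-depth-`δ` slice of `VP`: degree and complexity `≤ n^c + c` (the `VP` envelope, kept
explicit so that `PDClass δ ⊆ VPClass` is definitional; it is implied by the last conjunct up to
constants) AND an unbounded-fan-in circuit (tree `ArithCircuit`, weighted sum gates and product gates)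
computing `q` with product-depth `≤ δ n` (Limaye–Srinivasan–Tavenas' `Δ`, tree
`ArithCircuit.productDepth`) and at most `n^c + c` wires (`ArithCircuit.edgeSize`).  `δ = 1`: `ΣΠΣ`
circuits; `δ n = c₀ (log₂ n + 1)`: all of `VP` by VSBR. [cite: LimayeSrinivasanTavenas2021, §1–2] -/
def PDClass (δ : ℕ → ℕ) (n c : ℕ) (q : MvPolynomial (Fin n × Fin n) ℂ) : Prop :=
  q.totalDegree ≤ n ^ c + c ∧ complexity q ≤ n ^ c + c ∧
    ∃ P : ArithCircuit ℂ (Fin n × Fin n), P.Computes q ∧ P.productDepth ≤ δ n ∧ P.edgeSize ≤ n ^ c + c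

/-- The sparse slice: at most `n^c + c` monomials and total degree `≤ n^c + c` (the FLOOR class).
[folklore] -/
def SparseClass (n c : ℕ) (q : MvPolynomial (Fin n × Fin n) ℂ) : Prop :=
  q.support.card ≤ n ^ c + c ∧ q.totalDegree ≤ n ^ c + c

/-- Rung `δ` of the product-depth ladder. [folklore] -/
def ProductDepthRestorationQP (δ : ℕ → ℕ) : Prop := RestorationOn (PDClass δ)

/-- **RUNG 1 — `ΣΠΣ` RESTORATION (this line's target).**  Every matrix-symmetric family with
polynomial-size depth-three (`ΣΠΣ`, product-depth `≤ 1`) circuits over `ℂ` has square-symmetric circuits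
of quasi-polynomial orbit size.  Why it might fail: a matrix-symmetric `ΣΠΣ`-easy family all of whose
small depth-3 representations are asymmetric with cancellations (char-0 depth-3 power from high formal
degree) whose 0/1-values have counting width `(log n)^{ω(1)}` would be refuted from Dawar–Wilsenach's
support theorem (Thms 6.3–6.4). [conjecture-grade; cite: DawarWilsenach2025 §3.3 p.10 (depth-3 circuits
for `e_d` are fully symmetric), DwivediPagoSeppelt2026 Outlook (symmetric vs non-symmetric complexity),
LimayeSrinivasanTavenas2021 Thm 1] -/
def SigmaPiSigmaRestorationQP : Prop := ProductDepthRestorationQP fun _ => 1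

/-- **LIMIT OF THE LADDER** (= `X` modulo VSBR; not a prover target): restoration for the product-depth
`c₀ (log₂ n + 1)` slices, for every `c₀`. [conjecture-grade: equivalent to the crux given VSBR] -/
def LogDepthRestorationQP : Prop :=
  ∀ c₀ : ℕ, ProductDepthRestorationQP fun n => c₀ * (Nat.log 2 n + 1)

/-- An `Sym_n`-STABLE multiset of product terms of affine forms of quasi-polynomial size at level `n`
with constant `c`: every factor has total degree `≤ 1`, at most `2^((log₂ n + c)^c)` terms, each with at
most that many factors, and the diagonal action of every `σ ∈ Sym (Fin n)` maps the multiset of terms to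
itself. [folklore] -/
def IsEquivariantTerms (n c : ℕ) (T : Multiset (Multiset (MvPolynomial (Fin n × Fin n) ℂ))) : Prop :=
  (∀ m ∈ T, ∀ ℓ ∈ m, ℓ.totalDegree ≤ 1) ∧ Multiset.card T ≤ 2 ^ ((Nat.log 2 n + c) ^ c) ∧
    (∀ m ∈ T, Multiset.card m ≤ 2 ^ ((Nat.log 2 n + c) ^ c)) ∧
      ∀ σ : Equiv.Perm (Fin n),
        T.map (Multiset.map fun ℓ => MvPolynomial.rename (fun pq : Fin n × Fin n => σ • pq) ℓ) = T

/-! ### The stubs -/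

/-- **SUPERSEDED-MISCURRENCY (was stub A, `stub_equivariantTerms`, registered 2026-08-17 … 2026-08-28)** — EQUIVARIANT DEPTH-3
NORMAL FORM OF QP SIZE: a matrix-symmetric family with polynomial-size `ΣΠΣ` circuits is, at every level `n`, the sum of an EXACTLY
`Sym_n`-stable multiset of quasi-polynomially many products of quasi-polynomially many affine forms.  Kept as a proposition (not a
stub): it is strictly STRONGER than the rung needs (value orbits) and is obstructed by sign characters at top fan-in 1 — witness
`V_n = Π_{P<Q ∈ [n]²}(x_P − x_Q)` (`n` even; matrix-symmetric; its factor lines are permuted by the diagonal `Sym_n` but several orbits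
are reversed by transpositions, so no choice of representatives and no single-orbit term multiset is exactly stable, while `V_n` IS
restorable in value currency by pairing / untwisted support blocks).  No refutation of this proposition is claimed (that would need a
linear-span lower bound).  Its composition with the landed stub B is `SigmaPiSigmaRestorationQP_of` /
`sigmaPiSigmaRestorationQP_of_superseded` below. [conjecture-grade, superseded; cite: DvirShpilka2007, SaxenaSeshadhri2013] -/
def SupersededStubA : Prop :=
    ∀ f : (n : ℕ) → MvPolynomial (Fin n × Fin n) ℂ, IsMatrixSymmetric f →
      (∃ c : ℕ, ∀ n : ℕ, PDClass (fun _ => 1) n c (f n)) →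
      ∃ (T : (n : ℕ) → Multiset (Multiset (MvPolynomial (Fin n × Fin n) ℂ))) (c : ℕ),
        ∀ n : ℕ, IsEquivariantTerms n c (T n) ∧ ((T n).map Multiset.prod).sum = f n

/-- **A₁ — THE ΠΣ SUB-RUNG IN VALUE CURRENCY** (load-bearing for top fan-in 1; OPEN).  A matrix-symmetric family in the `ΣΠΣ`
slice `PDClass 1` which at every level is ONE scaled product of at most `n^c + c` affine forms (total degree `≤ 1`) has
square-symmetric circuits of quasi-polynomial ORBIT size.  Mechanism (value-orbit symmetrisation, landed `…ValueOrbit*.lean`): it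
suffices to compute `f n` by sums and products all of whose values and operand multisets have quasi-polynomial `Sym_n`-orbits —
equivalently (landed `…SupportForm.lean`) polylog rigid supports; factors are supported (`…AffineFactors.lean`), untwisted support
blocks and equivariant block systems restore (`…SupportBlocks.lean`, `…BlockProducts.lean`), and in any restoring computation every
value is supported and every operand multiset is exactly permuted by a small pointwise stabiliser (`…ValueSymSupport.lean`,
`…WideSymSupport.lean`); the residue is the pairing of TWISTED blocks (sign characters of `Sym(support)`).  Why it might fail: an
invariant affine product all of whose computations pass through an operand multiset of super-quasi-polynomial orbit (none known).
[conjecture-grade; cite: DawarWilsenach2025 §3.3, §6] -/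
theorem stub_piSigmaValue :
    ∀ f : (n : ℕ) → MvPolynomial (Fin n × Fin n) ℂ, IsMatrixSymmetric f →
      (∃ c : ℕ, ∀ n : ℕ, PDClass (fun _ => 1) n c (f n) ∧
        ∃ (a : ℂ) (L : Multiset (MvPolynomial (Fin n × Fin n) ℂ)),
          (∀ ℓ ∈ L, ℓ.totalDegree ≤ 1) ∧ Multiset.card L ≤ n ^ c + c ∧ f n = MvPolynomial.C a * L.prod) →
      ∃ c : ℕ, ∀ n : ℕ, QPOrbitRestorable c n (f n) := by
  sorry

/-- **A_k — THE ΣΠΣ(k) SUB-RUNG IN VALUE CURRENCY, FROM A₁ AND THE RANK BOUND** (bounded top fan-in; LANDED 2026-08-28, p594347, `Theorems/MonotoneRestorationOrbitRestorationQPSigmaPiSigmaK.lean`; was: provable now, size L).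
Given the Saxena–Seshadhri rank bound for simple minimal `ΣΠΣ(k,d)` identities — the NAMED LITERATURE FACT
`Literature.Computability.AlgebraicComplexity.depthThree_rankBound` (J. ACM 60 (2013) Thm 5), taken by name as a hypothesis — and
A₁, every matrix-symmetric `PDClass 1` family given at every level as a sum of at most `k` scaled products of at most `n^c + c`
affine forms is quasi-polynomially orbit-restorable.  Mechanism = Structure Theorem S (crux workfile
`Lines/depth-three-rung-stubA-bounded-fanin.md` §2): Karnin–Shpilka rank-distance clustering of a minimal representation at `≤ k`
scales is permuted by `Stab(f) ⊇ S_n`, cluster sums are `S_n`-fixed by minimality, each is (an `S_n × S_n`-invariant affine product)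
× `Q(Σ_p x_pp, Σ_{p≠q} x_pq)` (small stable spaces of affine forms are invariant: landed `StableForms.exists_eq_of_finrank`); A₁
restores the affine products, `Q(u₁,u₂)` is a free sum of invariant products.  Why it might fail: only by a gap in Theorem S (paper
proof in the workfile); `k` fixed (the clustering degrades beyond `k ≈ log n / log log n`). [cite: SaxenaSeshadhri2013, Theorem 5;
KarninShpilka2009 (rank distance)] -/
theorem stub_sigmaPiSigmaKValue (k : ℕ) :
    Literature.Computability.AlgebraicComplexity.depthThree_rankBound →
    (∀ f : (n : ℕ) → MvPolynomial (Fin n × Fin n) ℂ, IsMatrixSymmetric f →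
      (∃ c : ℕ, ∀ n : ℕ, PDClass (fun _ => 1) n c (f n) ∧
        ∃ (a : ℂ) (L : Multiset (MvPolynomial (Fin n × Fin n) ℂ)),
          (∀ ℓ ∈ L, ℓ.totalDegree ≤ 1) ∧ Multiset.card L ≤ n ^ c + c ∧ f n = MvPolynomial.C a * L.prod) →
      ∃ c : ℕ, ∀ n : ℕ, QPOrbitRestorable c n (f n)) →
    ∀ f : (n : ℕ) → MvPolynomial (Fin n × Fin n) ℂ, IsMatrixSymmetric f →
      (∃ c : ℕ, ∀ n : ℕ, PDClass (fun _ => 1) n c (f n) ∧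
        ∃ (a : Fin k → ℂ) (L : Fin k → Multiset (MvPolynomial (Fin n × Fin n) ℂ)),
          (∀ i, ∀ ℓ ∈ L i, ℓ.totalDegree ≤ 1) ∧ (∀ i, Multiset.card (L i) ≤ n ^ c + c) ∧
          f n = ∑ i, MvPolynomial.C (a i) * (L i).prod) →
      ∃ c : ℕ, ∀ n : ℕ, QPOrbitRestorable c n (f n) :=
  -- LANDED (p594347) over the Theorems-side copy of the vocabulary; the statements agree by `δ`-unfolding.
  Summit.ValiantsHypothesis.ValiantsHypothesis.Theorems.OrbitRestorationQPDepthThreeRung.stub_sigmaPiSigmaKValue k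

/-- **A_∞ — THE RUNG IN VALUE CURRENCY** (= `SigmaPiSigmaRestorationQP` unfolded through `ProductDepthRestorationQP` /
`RestorationOn`; the conjecture-grade RESIDUE: unbounded top fan-in, where rank bounds are vacuous).  Every matrix-symmetric family
with polynomial-size `ΣΠΣ` circuits has square-symmetric circuits of quasi-polynomial orbit size.  Entry point beyond bounded
fan-in (workfile §9): identifiable decompositions are equivariant, hence restorable; the residue is the non-identifiable symmetric
families.  Why it might fail: as for the rung (see `SigmaPiSigmaRestorationQP`). [conjecture-grade; cite: DawarWilsenach2025 §3.3,
LimayeSrinivasanTavenas2021 Thm 1] -/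
theorem stub_sigmaPiSigmaValue :
    ∀ f : (n : ℕ) → MvPolynomial (Fin n × Fin n) ℂ, IsMatrixSymmetric f →
      (∃ c : ℕ, ∀ n : ℕ, PDClass (fun _ => 1) n c (f n)) →
      ∃ c : ℕ, ∀ n : ℕ, QPOrbitRestorable c n (f n) := by
  sorry

/-- **B — SYMMETRIC CIRCUIT OF AN EQUIVARIANT TERM MULTISET** (LANDED 2026-08-27, p548827; was: provable now, size L).  An `Sym_n`-stable
multiset of qp many products of qp many affine forms is computed by a square-symmetric labelled circuit of
quasi-polynomial SIZE — variable gates, one constant gate per value, coefficient gates `a · x_pq`, one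
`+`-gate per (affine form, multiplicity index), one `×`-gate per (term, multiplicity index), one output
`+`-gate; the gate set is `Sym_n`-stable because the multiset is — hence of quasi-polynomial orbit size
(`orbitSize_le_size`).  Why it might fail: only by mis-typing (degenerate empty terms/multisets are
handled by constant gates). [folklore; cite: DawarWilsenach2025 §3.3; tree `SymmetricOrbitCircuit.lean`] -/
theorem stub_circuitOfEquivariantTerms :
    ∀ (T : (n : ℕ) → Multiset (Multiset (MvPolynomial (Fin n × Fin n) ℂ))) (c : ℕ),
      (∀ n : ℕ, IsEquivariantTerms n c (T n)) →
      ∃ c' : ℕ, ∀ n : ℕ, QPOrbitRestorable c' n (((T n).map Multiset.prod).sum) :=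
  -- LANDED (p548827) over the Theorems-side copy of the vocabulary; the statements agree by `δ`-unfolding.
  Summit.ValiantsHypothesis.ValiantsHypothesis.Theorems.OrbitRestorationQPDepthThreeRung.stub_circuitOfEquivariantTerms

/-- **LIMIT — LOG-PRODUCT-DEPTH RESTORATION** (the ladder's top; `X`-equivalent given VSBR, see
`logDepthRestorationQP_of_orbitRestorationQP` and `OrbitRestorationQP_of_ladder`; registered to make the ladder kernel-visible, NOT a prover
target). Stated in full (= `LogDepthRestorationQP` unfolded through `ProductDepthRestorationQP` / `RestorationOn`, see `logDepth_stub_iff`). [conjecture-grade: summit-strength of the crux] -/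
theorem stub_logDepthRestoration :
    ∀ c₀ : ℕ, ∀ f : (n : ℕ) → MvPolynomial (Fin n × Fin n) ℂ, IsMatrixSymmetric f →
      (∃ c : ℕ, ∀ n : ℕ, PDClass (fun n => c₀ * (Nat.log 2 n + 1)) n c (f n)) →
      ∃ c : ℕ, ∀ n : ℕ, QPOrbitRestorable c n (f n) := by
  sorry

/-- Bookkeeping (kernel-checked): the full text of `stub_logDepthRestoration` IS the abbreviation
`LogDepthRestorationQP` (`δ`-unfolding of `ProductDepthRestorationQP` / `RestorationOn`). [folklore] -/
theorem logDepth_stub_iff :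
    LogDepthRestorationQP ↔
    ∀ c₀ : ℕ, ∀ f : (n : ℕ) → MvPolynomial (Fin n × Fin n) ℂ, IsMatrixSymmetric f →
      (∃ c : ℕ, ∀ n : ℕ, PDClass (fun n => c₀ * (Nat.log 2 n + 1)) n c (f n)) →
      ∃ c : ℕ, ∀ n : ℕ, QPOrbitRestorable c n (f n) :=
  Iff.rfl

/-- **VSBR — `VP` HAS POLYNOMIAL-SIZE CIRCUITS OF PRODUCT-DEPTH `O(log n)`** (LANDED 2026-08-27, p581292,
`Theorems/MonotoneRestorationOrbitRestorationQPVsbr.lean` over `Literature/…/VSBRProductDepth.lean`; Valiant–Skyum–Berkowitz–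
Rackoff 1983; Bürgisser 2000 TCS Thm 2.5), typed on the slices: a family with degree and complexity
`≤ n^c + c` has, for some `c₀, c'`, circuits of product-depth `≤ c₀ (log₂ n + 1)` with `≤ n^{c'} + c'`
wires (the VSBR normal form squares degree at every product layer, so its product-depth is
`≤ log₂ d + 1 ≤ c (log₂ n + 1) + 1`).  Literature theorem, in-tree infrastructure
`GateQuotients.lean` / `VSBRStages.lean`; size L. [cite: ValiantSkyumBerkowitzRackoff1983; Burgisser2000TCS
Thm 2.5] -/
theorem stub_vsbr :
    ∀ f : (n : ℕ) → MvPolynomial (Fin n × Fin n) ℂ, (∃ c : ℕ, ∀ n : ℕ, VPClass n c (f n)) →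
      ∃ c₀ c' : ℕ, ∀ n : ℕ, PDClass (fun n => c₀ * (Nat.log 2 n + 1)) n c' (f n) :=
  -- LANDED (p581292) over the Theorems-side copy of the vocabulary; the statements agree by `δ`-unfolding.
  Summit.ValiantsHypothesis.ValiantsHypothesis.Theorems.OrbitRestorationQPDepthThreeRung.stub_vsbr

/-! ### Proved glue -/

/-- Monotonicity of the p-bound `n^c + c` in `c` (with the `0^0 = 1` corner). [folklore] -/
theorem pbound_mono {c c' : ℕ} (h : c ≤ c') (n : ℕ) : n ^ c + c ≤ n ^ c' + c' := by
  rcases Nat.eq_zero_or_pos n with rfl | hn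
  · rcases Nat.eq_zero_or_pos c with rfl | hc
    · rcases Nat.eq_zero_or_pos c' with rfl | hc'
      · simp
      · simp [Nat.zero_pow hc']; omega
    · have hc' : 0 < c' := lt_of_lt_of_le hc h
      simp [Nat.zero_pow hc, Nat.zero_pow hc']; exact h
  · exact Nat.add_le_add (Nat.pow_le_pow_right hn h) h

/-- `RestorationOn` is antitone in the class (with room for a change of constant). [folklore] -/
theorem restorationOn_antitone {𝒞 𝒟 : (n : ℕ) → ℕ → MvPolynomial (Fin n × Fin n) ℂ → Prop}
    (h : ∀ c : ℕ, ∃ c' : ℕ, ∀ (n : ℕ) (q : MvPolynomial (Fin n × Fin n) ℂ), 𝒞 n c q → 𝒟 n c' q) :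
    RestorationOn 𝒟 → RestorationOn 𝒞 := by
  intro hD f hsym ⟨c, hc⟩
  obtain ⟨c', hc'⟩ := h c
  exact hD f hsym ⟨c', fun n => hc' n (f n) (hc n)⟩

/-- `PDClass δ ⊆ VPClass` (definitional). [folklore] -/
theorem vpClass_of_pdClass {δ : ℕ → ℕ} {n c : ℕ} {q : MvPolynomial (Fin n × Fin n) ℂ}
    (h : PDClass δ n c q) : VPClass n c q := ⟨h.1, h.2.1⟩

/-- `PDClass` is monotone in the depth budget. [folklore] -/
theorem pdClass_mono {δ δ' : ℕ → ℕ} (hδ : ∀ n, δ n ≤ δ' n) {n c : ℕ}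
    {q : MvPolynomial (Fin n × Fin n) ℂ} (h : PDClass δ n c q) : PDClass δ' n c q := by
  obtain ⟨hd, hc, P, hP, hΔ, hE⟩ := h
  exact ⟨hd, hc, P, hP, hΔ.trans (hδ n), hE⟩

/-- A family in the slices `VPClass n c` is a `VP` family. [folklore] -/
theorem isVPFamily_of_vpClass {f : (n : ℕ) → MvPolynomial (Fin n × Fin n) ℂ}
    (h : ∃ c : ℕ, ∀ n : ℕ, VPClass n c (f n)) : IsVPFamily f := by
  obtain ⟨c, hc⟩ := h
  refine ⟨⟨⟨2, fun n => ?_⟩, ⟨c, fun n => (hc n).1⟩⟩, ⟨c, fun n => (hc n).2⟩⟩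
  simp only [Fintype.card_prod, Fintype.card_fin]
  nlinarith

/-- A `VP` family lies in the slices `VPClass n c` for one `c`. [folklore] -/
theorem vpClass_of_isVPFamily {f : (n : ℕ) → MvPolynomial (Fin n × Fin n) ℂ} (h : IsVPFamily f) :
    ∃ c : ℕ, ∀ n : ℕ, VPClass n c (f n) := by
  obtain ⟨⟨-, c₁, h₁⟩, c₂, h₂⟩ := h
  refine ⟨c₁ + c₂, fun n => ⟨(h₁ n).trans (pbound_mono (by omega) n), ?_⟩⟩
  exact (h₂ n).trans (pbound_mono (by omega) n)

/-- **`X ↔ RestorationOn VPClass`**: the crux is the top slice of the graded family. [folklore] -/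
theorem orbitRestorationQP_iff : OrbitRestorationQP ↔ RestorationOn VPClass := by
  constructor
  · intro hX f hsym hcls
    exact hX f hsym (isVPFamily_of_vpClass hcls)
  · intro hR f hsym hVP
    exact hR f hsym (vpClass_of_isVPFamily hVP)

/-- **ON-PATH**: the crux implies every rung of the product-depth ladder (in particular the `ΣΠΣ`
rung and the limit). [folklore] -/
theorem onPath (δ : ℕ → ℕ) : OrbitRestorationQP → ProductDepthRestorationQP δ := by
  intro hX
  exact restorationOn_antitone (fun c => ⟨c, fun _ _ hq => vpClass_of_pdClass hq⟩)
    (orbitRestorationQP_iff.1 hX)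

/-- On-path for the rung of this line. [folklore] -/
theorem sigmaPiSigmaRestorationQP_of_orbitRestorationQP :
    OrbitRestorationQP → SigmaPiSigmaRestorationQP := onPath _

/-- The limit of the ladder is implied by the crux (so, with `OrbitRestorationQP_of_ladder`, it is
`X`-equivalent given VSBR). [folklore] -/
theorem logDepthRestorationQP_of_orbitRestorationQP : OrbitRestorationQP → LogDepthRestorationQP :=
  fun hX _ => onPath _ hX

/-- Lower rungs follow from higher ones: constant product-depth `Δ ≥ 1` gives the `ΣΠΣ` rung.
[folklore] -/
theorem sigmaPiSigma_of_productDepth {Δ : ℕ} (hΔ : 1 ≤ Δ) :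
    ProductDepthRestorationQP (fun _ => Δ) → SigmaPiSigmaRestorationQP :=
  restorationOn_antitone fun c => ⟨c, fun _ _ hq => pdClass_mono (fun _ => hΔ) hq⟩

/-- Every constant-depth rung follows from the limit. [folklore] -/
theorem productDepth_of_logDepth (Δ : ℕ) :
    LogDepthRestorationQP → ProductDepthRestorationQP (fun _ => Δ) := fun h =>
  restorationOn_antitone (fun c => ⟨c, fun _ _ hq => pdClass_mono (fun n => by nlinarith) hq⟩) (h Δ)

/-! ### The floor is a theorem (F3 witness; also published stand-alone as `Lines/DepthThreeRung_special.lean`) -/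

/-- `2^m + c ≤ 2^(m + c)`. [folklore] -/
theorem two_pow_add_le (m c : ℕ) : 2 ^ m + c ≤ 2 ^ (m + c) := by
  induction c with
  | zero => simp
  | succ c ih =>
    have h1 : 1 ≤ 2 ^ m := Nat.one_le_two_pow
    calc 2 ^ m + (c + 1) ≤ 2 * (2 ^ m + c) := by omega
      _ ≤ 2 * 2 ^ (m + c) := Nat.mul_le_mul_left 2 ih
      _ = 2 ^ (m + (c + 1)) := by ring

/-- A p-bound is a qp-bound: `n^c + c ≤ 2^((log₂ n + c₂)^c₂)` with `c₂ = 2c + 1`. [folklore] -/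
theorem poly_le_qp (c : ℕ) : ∃ c₂ : ℕ, ∀ n : ℕ, n ^ c + c ≤ 2 ^ ((Nat.log 2 n + c₂) ^ c₂) := by
  refine ⟨2 * c + 1, fun n => ?_⟩
  have hL : n < 2 ^ (Nat.log 2 n + 1) := Nat.lt_pow_succ_log_self Nat.one_lt_two n
  generalize Nat.log 2 n = L at hL ⊢
  rcases Nat.eq_zero_or_pos c with rfl | hc
  · simp [Nat.one_le_two_pow]
  · have h1 : n ^ c ≤ 2 ^ ((L + 1) * c) := by
      calc n ^ c ≤ (2 ^ (L + 1)) ^ c := Nat.pow_le_pow_left hL.le c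
        _ = 2 ^ ((L + 1) * c) := (pow_mul 2 (L + 1) c).symm
    have h2 : n ^ c + c ≤ 2 ^ ((L + 1) * c + c) :=
      (Nat.add_le_add_right h1 c).trans (two_pow_add_le _ _)
    have h3 : (L + 1) * c + c ≤ (L + (2 * c + 1)) ^ (2 * c + 1) := by
      have hB1 : 1 ≤ L + (2 * c + 1) := by omega
      calc (L + 1) * c + c = c * (L + 2) := by ring
        _ ≤ (L + (2 * c + 1)) * (L + (2 * c + 1)) := Nat.mul_le_mul (by omega) (by omega)
        _ = (L + (2 * c + 1)) ^ 2 := (sq _).symm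
        _ ≤ (L + (2 * c + 1)) ^ (2 * c + 1) := Nat.pow_le_pow_right hB1 (by omega)
    exact h2.trans (Nat.pow_le_pow_right (by norm_num) h3)

/-- **THE FLOOR IS PROVED**: `RestorationOn SparseClass` (the orbit circuit of the tree; no `sorry`).
[folklore] -/
theorem sparseRestorationQP : RestorationOn SparseClass := by
  intro f hsym hcls
  obtain ⟨c, hc⟩ := hcls
  obtain ⟨c₂, hc₂⟩ := poly_le_qp c
  obtain ⟨c', hc'⟩ :=
    Summit.ValiantsHypothesis.ValiantsHypothesis.Theorems.SparseRegime.qpSparse_size_le c₂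
  refine ⟨c', fun n => ?_⟩
  have hinv : ∀ σ : Equiv.Perm (Fin n),
      MvPolynomial.rename (fun pq : Fin n × Fin n => σ • pq) (f n) = f n := fun σ => hsym n σ σ
  obtain ⟨G, inst, C, hCs, hCe, hCc⟩ := OrbitCircuit.exists_symmetric_circuit_of_invariant (f n) hinv
  refine ⟨G, inst, C, hCs, hCe, ?_⟩
  calc C.orbitSize (Equiv.Perm (Fin n)) ≤ C.size := C.orbitSize_le_size _
    _ = Fintype.card G := rfl
    _ ≤ _ := hCc
    _ ≤ 2 ^ ((Nat.log 2 n + c') ^ c') :=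
        hc' n _ _ ((hc n).1.trans (hc₂ n)) ((hc n).2.trans (hc₂ n))

/-! ### The two compositions -/

/-- **THE RUNG FROM ITS STUBS**: A (equivariant normal form) and B (its symmetric circuit) give
`ΣΠΣ` restoration. [folklore] -/
theorem SigmaPiSigmaRestorationQP_of :
    (∀ f : (n : ℕ) → MvPolynomial (Fin n × Fin n) ℂ, IsMatrixSymmetric f →
      (∃ c : ℕ, ∀ n : ℕ, PDClass (fun _ => 1) n c (f n)) →
      ∃ (T : (n : ℕ) → Multiset (Multiset (MvPolynomial (Fin n × Fin n) ℂ))) (c : ℕ),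
        ∀ n : ℕ, IsEquivariantTerms n c (T n) ∧ ((T n).map Multiset.prod).sum = f n) →
    (∀ (T : (n : ℕ) → Multiset (Multiset (MvPolynomial (Fin n × Fin n) ℂ))) (c : ℕ),
      (∀ n : ℕ, IsEquivariantTerms n c (T n)) →
      ∃ c' : ℕ, ∀ n : ℕ, QPOrbitRestorable c' n (((T n).map Multiset.prod).sum)) →
    SigmaPiSigmaRestorationQP := by
  intro hA hB f hsym hcls
  obtain ⟨T, c, hT⟩ := hA f hsym hcls
  obtain ⟨c', hc'⟩ := hB T c fun n => (hT n).1
  exact ⟨c', fun n => (hT n).2 ▸ hc' n⟩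

/-- The rung from the superseded stub A and the landed stub B (kept for the record: the old cut WAS sufficient).
[folklore] -/
theorem sigmaPiSigmaRestorationQP_of_superseded (hA : SupersededStubA) : SigmaPiSigmaRestorationQP :=
  SigmaPiSigmaRestorationQP_of hA stub_circuitOfEquivariantTerms

/-- **The rung from A_∞** (zero hypotheses; `sorry` only inside `stub_sigmaPiSigmaValue`; definitional unfolding of
`SigmaPiSigmaRestorationQP = RestorationOn (PDClass 1)`). [folklore] -/
theorem sigmaPiSigmaRestorationQP_of_stubs : SigmaPiSigmaRestorationQP :=
  fun f hsym hcls => stub_sigmaPiSigmaValue f hsym hcls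

/-- **ON-PATH for A₁**: the rung in value currency implies the ΠΣ sub-rung (drop the product shape). [folklore] -/
theorem piSigmaValue_of_sigmaPiSigmaValue
    (hA : ∀ f : (n : ℕ) → MvPolynomial (Fin n × Fin n) ℂ, IsMatrixSymmetric f →
      (∃ c : ℕ, ∀ n : ℕ, PDClass (fun _ => 1) n c (f n)) → ∃ c : ℕ, ∀ n : ℕ, QPOrbitRestorable c n (f n)) :
    ∀ f : (n : ℕ) → MvPolynomial (Fin n × Fin n) ℂ, IsMatrixSymmetric f →
      (∃ c : ℕ, ∀ n : ℕ, PDClass (fun _ => 1) n c (f n) ∧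
        ∃ (a : ℂ) (L : Multiset (MvPolynomial (Fin n × Fin n) ℂ)),
          (∀ ℓ ∈ L, ℓ.totalDegree ≤ 1) ∧ Multiset.card L ≤ n ^ c + c ∧ f n = MvPolynomial.C a * L.prod) →
      ∃ c : ℕ, ∀ n : ℕ, QPOrbitRestorable c n (f n) :=
  fun f hsym ⟨c, hc⟩ => hA f hsym ⟨c, fun n => (hc n).1⟩

/-- **ON-PATH for A_k**: the rung in value currency implies the conclusion of the ΣΠΣ(k) sub-rung (drop the shape). [folklore] -/
theorem sigmaPiSigmaK_of_sigmaPiSigmaValue (k : ℕ)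
    (hA : ∀ f : (n : ℕ) → MvPolynomial (Fin n × Fin n) ℂ, IsMatrixSymmetric f →
      (∃ c : ℕ, ∀ n : ℕ, PDClass (fun _ => 1) n c (f n)) → ∃ c : ℕ, ∀ n : ℕ, QPOrbitRestorable c n (f n)) :
    ∀ f : (n : ℕ) → MvPolynomial (Fin n × Fin n) ℂ, IsMatrixSymmetric f →
      (∃ c : ℕ, ∀ n : ℕ, PDClass (fun _ => 1) n c (f n) ∧
        ∃ (a : Fin k → ℂ) (L : Fin k → Multiset (MvPolynomial (Fin n × Fin n) ℂ)),
          (∀ i, ∀ ℓ ∈ L i, ℓ.totalDegree ≤ 1) ∧ (∀ i, Multiset.card (L i) ≤ n ^ c + c) ∧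
          f n = ∑ i, MvPolynomial.C (a i) * (L i).prod) →
      ∃ c : ℕ, ∀ n : ℕ, QPOrbitRestorable c n (f n) :=
  fun f hsym ⟨c, hc⟩ => hA f hsym ⟨c, fun n => (hc n).1⟩

/-- **THE DEFERRED KEY**: with the rank bound (named fact) and A₁ landed, A_k closes the bounded-fan-in sub-rung (this is just the
stub's shape; recorded so the composition is kernel-visible). [folklore] -/
theorem sigmaPiSigmaK_of_keys (k : ℕ) (hRB : Literature.Computability.AlgebraicComplexity.depthThree_rankBound)
    (hA₁ : ∀ f : (n : ℕ) → MvPolynomial (Fin n × Fin n) ℂ, IsMatrixSymmetric f →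
      (∃ c : ℕ, ∀ n : ℕ, PDClass (fun _ => 1) n c (f n) ∧
        ∃ (a : ℂ) (L : Multiset (MvPolynomial (Fin n × Fin n) ℂ)),
          (∀ ℓ ∈ L, ℓ.totalDegree ≤ 1) ∧ Multiset.card L ≤ n ^ c + c ∧ f n = MvPolynomial.C a * L.prod) →
      ∃ c : ℕ, ∀ n : ℕ, QPOrbitRestorable c n (f n)) :
    ∀ f : (n : ℕ) → MvPolynomial (Fin n × Fin n) ℂ, IsMatrixSymmetric f →
      (∃ c : ℕ, ∀ n : ℕ, PDClass (fun _ => 1) n c (f n) ∧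
        ∃ (a : Fin k → ℂ) (L : Fin k → Multiset (MvPolynomial (Fin n × Fin n) ℂ)),
          (∀ i, ∀ ℓ ∈ L i, ℓ.totalDegree ≤ 1) ∧ (∀ i, Multiset.card (L i) ≤ n ^ c + c) ∧
          f n = ∑ i, MvPolynomial.C (a i) * (L i).prod) →
      ∃ c : ℕ, ∀ n : ℕ, QPOrbitRestorable c n (f n) :=
  stub_sigmaPiSigmaKValue k hRB hA₁

/-- **THE TOP SLICE FROM THE TOP OF THE LADDER**: the limit rung and VSBR give restoration on all of
`VPClass` (stated on `RestorationOn VPClass` so that exactly one theorem of this file concludes the crux by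
name, see `OrbitRestorationQP_of_ladder`). [folklore] -/
theorem restorationOnVP_of_ladder :
    LogDepthRestorationQP →
    (∀ f : (n : ℕ) → MvPolynomial (Fin n × Fin n) ℂ, (∃ c : ℕ, ∀ n : ℕ, VPClass n c (f n)) →
      ∃ c₀ c' : ℕ, ∀ n : ℕ, PDClass (fun n => c₀ * (Nat.log 2 n + 1)) n c' (f n)) →
    RestorationOn VPClass := by
  intro hL hV f hsym hcls
  obtain ⟨c₀, c', h⟩ := hV f hcls
  exact hL c₀ f hsym ⟨c', h⟩

/-- **THE CRUX FROM THE LADDER, BY NAME** (the skeleton theorem: concludes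
`Theses.MonotoneRestoration.OrbitRestorationQP` literally, no hypotheses, `sorry` only inside the declared
stubs `stub_logDepthRestoration` (the limit rung — crux-strength, not a target) and `stub_vsbr` (a 1983
theorem); the rung enters through `productDepth_of_logDepth` / `sigmaPiSigma_of_productDepth` as the first
slice of the limit). [folklore] -/
theorem OrbitRestorationQP_of_ladder : OrbitRestorationQP :=
  orbitRestorationQP_iff.2 (restorationOnVP_of_ladder stub_logDepthRestoration stub_vsbr)

end Summit.ValiantsHypothesis.ValiantsHypothesis.Cruxes.OrbitRestorationQP.DepthThreeRung
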